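import Mathlib

/-!
# Line representatives of `K²` and punctured lines
# (crux `LevelGradedCohnUmans.GradedDesignFamily`, stmt-MatrixMultiplication-7610; negative side,
# line `quadratic-extension-level-one-cell`, stub S3 `stub_subfieldCell`)

HONEST FRAMING.  Support for a THEOREM about the finite cells of S3 (the sharp uniform counting
wall, `SubfieldCellUniformWallSharp`); a verdict / certificate tool, not summit progress.

The `|K| + 1` line representatives `LR = {(0, 1)} ∪ {(1, x) : x ∈ K}` used by `cuspFormWall` /
`cuspFormWall_sharp` form an EXACT system of representatives of the lines of `K²`:
* `lineRep_cover` — every vector is a multiple of one of them;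
* `lineRep_eq_of_smul` — two proportional representatives are equal;
* `puncturedLine_iff` — the punctured line `Kˣ·(1, θ)` in coordinates
  (`w₀ ≠ 0 ∧ w₁ = w₀ θ`);
* `lineRep_count` — hence for every `A ∈ GL₂(K)` exactly ONE representative `ℓ` has
  `A ℓ ∈ Kˣ·(1, θ)`: `Σ_{ℓ ∈ LR} [A ℓ ∈ Kˣ·(1, θ)] = 1`.  This is hypothesis `hκ0` of
  `cuspFormWall_sharp` for the constant "Steinberg" kernel family `κ_ℓ = 1_{Kˣ·(1, θ)}`.

Sorry-free; axioms `propext`, `Classical.choice`, `Quot.sound`.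
-/

set_option linter.dupNamespace false

open scoped BigOperators
open Matrix

namespace Summit.MatrixMultiplication.MatrixMultiplication.Theorems.GradedDesignFamily.Negative

section Lines

variable {K : Type} [Field K] [Fintype K] [DecidableEq K]

/-- The line representatives `(0, 1)`, `(1, x)` cover `K²` up to scalars. [folklore] -/
theorem lineRep_cover (u : Fin 2 → K) :
    ∃ ℓ ∈ insert ![0, 1] (Finset.univ.image fun x : K => ![1, x]), ∃ c : K, u = c • ℓ := by
  by_cases h0 : u 0 = 0
  · refine ⟨![0, 1], Finset.mem_insert_self _ _, u 1, ?_⟩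
    funext i
    fin_cases i
    · simp [h0]
    · simp
  · refine ⟨![1, u 1 / u 0], Finset.mem_insert_of_mem (Finset.mem_image.2 ⟨u 1 / u 0,
      Finset.mem_univ _, rfl⟩), u 0, ?_⟩
    funext i
    fin_cases i
    · simp
    · simp [mul_div_cancel₀ _ h0]

/-- Two proportional line representatives are equal. [folklore] -/
theorem lineRep_eq_of_smul {ℓ₁ ℓ₂ : Fin 2 → K}
    (h₁ : ℓ₁ ∈ insert ![0, 1] (Finset.univ.image fun x : K => ![1, x]))
    (h₂ : ℓ₂ ∈ insert ![0, 1] (Finset.univ.image fun x : K => ![1, x]))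
    (c : K) (h : ℓ₂ = c • ℓ₁) : ℓ₁ = ℓ₂ := by
  simp only [Finset.mem_insert, Finset.mem_image, Finset.mem_univ, true_and] at h₁ h₂
  have e0 := congrFun h 0
  have e1 := congrFun h 1
  rcases h₁ with rfl | ⟨x, rfl⟩ <;> rcases h₂ with rfl | ⟨x', rfl⟩
  · rfl
  · simp at e0
  · simp at e0 e1
    rw [← e0] at e1
    simp at e1
  · simp at e0 e1
    rw [← e0, one_mul] at e1
    rw [e1]

omit [Fintype K] [DecidableEq K] in
/-- The punctured line `Kˣ · (1, θ)` in coordinates. -/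
theorem puncturedLine_iff (θ : K) (w : Fin 2 → K) :
    (w 0 ≠ 0 ∧ w 1 = w 0 * θ) ↔ ∃ c : K, c ≠ 0 ∧ w = c • ![1, θ] := by
  constructor
  · rintro ⟨h0, h1⟩
    refine ⟨w 0, h0, ?_⟩
    funext i
    fin_cases i
    · simp
    · simp [h1]
  · rintro ⟨c, hc, rfl⟩
    simp [hc]

/-- **Exactly one line representative in each punctured line** (pushed through any `A ∈ GL₂(K)`):
`#{ℓ ∈ LR : A ℓ ∈ Kˣ·(1, θ)} = 1`. [folklore] -/
theorem lineRep_count (A : Matrix.GeneralLinearGroup (Fin 2) K) (θ : K) :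
    ∑ ℓ ∈ insert ![0, 1] (Finset.univ.image fun x : K => ![1, x]),
      (if ((A : Matrix (Fin 2) (Fin 2) K) *ᵥ ℓ) 0 ≠ 0 ∧
          ((A : Matrix (Fin 2) (Fin 2) K) *ᵥ ℓ) 1 = ((A : Matrix (Fin 2) (Fin 2) K) *ᵥ ℓ) 0 * θ
        then (1 : ℂ) else 0) = 1 := by
  set v : Fin 2 → K := (A⁻¹ : Matrix.GeneralLinearGroup (Fin 2) K).val *ᵥ ![1, θ] with hv_def
  have hv : (A : Matrix (Fin 2) (Fin 2) K) *ᵥ v = ![1, θ] := by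
    rw [hv_def, Matrix.mulVec_mulVec, ← Units.val_mul, mul_inv_cancel, Units.val_one,
      Matrix.one_mulVec]
  have hv0 : v ≠ 0 := by
    intro h
    have := congrFun hv 0
    rw [h, Matrix.mulVec_zero] at this
    simp at this
  have key : ∀ ℓ : Fin 2 → K, (((A : Matrix (Fin 2) (Fin 2) K) *ᵥ ℓ) 0 ≠ 0 ∧
      ((A : Matrix (Fin 2) (Fin 2) K) *ᵥ ℓ) 1 = ((A : Matrix (Fin 2) (Fin 2) K) *ᵥ ℓ) 0 * θ) ↔
      ∃ c : K, c ≠ 0 ∧ ℓ = c • v := by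
    intro ℓ
    rw [puncturedLine_iff]
    refine exists_congr fun c => and_congr_right fun _ => ?_
    constructor
    · intro h
      have h2 : (A⁻¹ : Matrix.GeneralLinearGroup (Fin 2) K).val *ᵥ
          ((A : Matrix (Fin 2) (Fin 2) K) *ᵥ ℓ) =
          (A⁻¹ : Matrix.GeneralLinearGroup (Fin 2) K).val *ᵥ (c • ![1, θ]) := by rw [h]
      rwa [Matrix.mulVec_mulVec, ← Units.val_mul, inv_mul_cancel, Units.val_one,
        Matrix.one_mulVec, Matrix.mulVec_smul] at h2
    · rintro rfl
      rw [Matrix.mulVec_smul, hv]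
  obtain ⟨ℓ₀, hℓ₀, c₀, hc₀⟩ := lineRep_cover v
  have hc₀0 : c₀ ≠ 0 := by
    rintro rfl
    rw [zero_smul] at hc₀
    exact hv0 hc₀
  have hℓ₀v : ℓ₀ = c₀⁻¹ • v := by rw [hc₀, smul_smul, inv_mul_cancel₀ hc₀0, one_smul]
  rw [Finset.sum_eq_single_of_mem ℓ₀ hℓ₀ fun ℓ hℓ hne => ?_, if_pos ((key ℓ₀).2
    ⟨c₀⁻¹, inv_ne_zero hc₀0, hℓ₀v⟩)]
  rw [if_neg]
  intro hP
  obtain ⟨c, -, hℓc⟩ := (key ℓ).1 hP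
  apply hne
  refine (lineRep_eq_of_smul hℓ₀ hℓ (c * c₀) ?_).symm
  rw [hℓc, hc₀, smul_smul]

end Lines

end Summit.MatrixMultiplication.MatrixMultiplication.Theorems.GradedDesignFamily.Negative
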